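import Summits.QuantumFields.BalabanUV.T4Continuum.Support.NE7HapeOfLocalChartBudget
import HarnessLib

/-!
# NE7HapeOfLocalChartWide — THE COVERING LIFT WITH A FREE COVER FACTOR `Kc ≥ 4ℓ + 12`: `hape_of_localChart_budget` for every coarse torus `N ≥ 1` from the chart
# hypothesis on the `Kc`-fold cover (F282w; F282 `NE7HapeOfLocalChartAllN` is the case `Kc = 4ℓ + 12`)

Cell `pub-balaban`, rung (B)+1 sub-cell t4, lineage `b2b-balaban-t4-ne7-p1` (CRUX PROVER NE7 #1 = OWNER of row NE7), generation 91; memo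
`t4/b2b-balaban-t4-ne7-p1-g91/COVER-OBSTRUCTION.md`.  File F282w (over F281 `NE7HapeOfLocalChartBudget.hape_of_localChart_budget`, p2's
`NE7TangentCriticalCover.tanCritical_cover` ∕ `isPeriodicCfg_mul`, row NE3's `tangentIter_iff_dirIter_eq_zero`), the REPAIR of F282.

WHY.  F282 fixed the cover factor at `4ℓ + 12` (the least F281 allows).  On that cover the chart ball `torusSupNorm (y − z) ≤ (nbRad + 2ℓ + 10)·M` is the WHOLE
torus whenever `N(4ℓ+12) ≤ 2(nbRad + 2ℓ + 10)` (every `ℓ` at `N = 1`), so the chart hypothesis is a GLOBAL chart, which torons refute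
(`NE7LocalChartCoverObstruction.not_chart_cover12`).  With the cover factor FREE the consumer takes `Kc ≥ 2·nbRad (d+1) L + 4ℓ + 24`: then the chart ball
(radius `(nbRad + 2ℓ + 10)M`, plus a collar `2M`) is a proper sub-box of the cover torus (half-period `≥ (nbRad + 2ℓ + 12)M`), torons are locally pure
gauges, and the chart hypothesis is the LOCAL [B8] Thm 2 at `U₀ = 1` it was meant to be.  Everything else is F282 verbatim: a tangent-critical admissible `U`
of period `N·M` is one of period `N·Kc·M` (`tanCritical_cover`), class, datum and `SmallField` are period-blind, F281 applies at `N·Kc ≥ 4ℓ + 12`.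
WHAT ([folklore] composition; 0 def, 0 sorry).  **`hape_of_localChart_budget_wide`**: F281's statement with `N ≥ 1` arbitrary, a cover factor `Kc ≥ 4ℓ + 12`, and
the chart hypothesis at period `N·Kc`.
HONEST FRAMING (page 1): composition BY NAME; the chart (N1)-weak and the budget inequalities are HYPOTHESES asserted for nothing; nothing of Bałaban's asserted; NOT (APE)
unconditionally, NOT ONE-STEP, NOT NE7; spine 0∕9; finite T⁴ rung (B)+1 — NOT infinite volume, NOT mass gap, NOT `BetaPertH`, NOT Clay.  Continuum YM on T⁴ ⇐
BetaPertH ∧ nine spine estimates (0/9 proved); BetaPertH ⇐ (D1) ∧ (D4) ∧ CAP+tail; G-an2-4 gates asym, D1 and NE2/3/4.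
-/

set_option autoImplicit false

open scoped BigOperators Matrix.Norms.L2Operator
open NormedSpace Finset Set

namespace Summit.QuantumFields.BalabanUV.T4Continuum.NE7HapeOfLocalChartWide

open Literature.MathematicalPhysics.QuantumFieldTheory.Balaban1983to89
open B7Prop1Explicit B7Prop2Explicit MatrixLog UnitaryModel
open B4TorusKernel.MultiPeriod (torusSupNorm)
open T4AveragingDeficitWall (IsUnitaryCfg IsSkewDir SmallField vary curlAt dirL1)
open T4AveragingDeficitWallBoundary (IsPeriodicCfg periodBox)
open AveragingDeficitPeriodicCounting (IsPeriodicDir)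
open AveragingDeficitMultiLevelPrep (LevelSmall TangentIter cavgIter)
open AveragingDeficitMultiLevelBridge (cavgIter_eq_avgIter)
open BlockAverageVaryHolo (nbRad)
open BlockAverageVaryDisc (rho0)
open MinimalActionLevels (perWin)
open MinimalActionSandwich (admissible)
open MinimalActionRate (sfClass)
open NE3HessForm (dAction)
open NE3TangentCovariantTower (dirIter)
open NE3TangentFlatStructure (Qcoarse)
open B5Prop11Plancherel (Tor fine)
open B5Blocks16 (blockOf)
open B6LowerBound2153Torus (toT rep)
open B4Sect5Proof (latticeConst)
open B5Hk163Strip (kappa163)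
open B5Hk163TorusHolderDecay (CdecD)
open NE3QbarIterCovLiftPrep (cruxC)
open NE3RightInverseSolveLetters (thetaLoc)
open NE3HatInvCurlLetters (curl1C curl1C_nonneg)
open NE3EnergyShapes (IsUnitarySite)
open BlockAveragePushDirSplit (flat)
open NE7ApeOfTorusRoadV4 (hape_of_torusRoadV4)
open NE7HapeOfLocalChartBudget (hape_of_localChart_budget)
open NE3TangentCovariantTower (dirIter tangentIter_iff_dirIter_eq_zero)
open NE7TangentCriticalCover (tanCritical_cover isPeriodicCfg_mul)
open AveragingDeficitMultiLevelBridge (cavgIter_eq_avgIter)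

noncomputable section

variable {d : ℕ} {n : Type*} [Fintype n] [DecidableEq n]

/-- **`hape` FROM THE LOCAL CHART ON THE `Kc`-FOLD COVER AND THE BUDGET, EVERY `N ≥ 1`, EVERY `Kc ≥ 4ℓ + 12`** (statement: module docstring).
[cite: Balaban1985Variational, Prop. 8 p.304] -/
theorem hape_of_localChart_budget_wide [Nonempty n] {L : ℕ} [NeZero L] (hL : 2 ≤ L) :
    ∃ K c : ℝ, 0 ≤ K ∧ 0 < c ∧ ∀ (N ℓ Kc : ℕ) [NeZero N] (ε δ δ₁ β c₀ θ C₀ C₁ : ℝ), 1 ≤ ℓ → 4 * ℓ + 12 ≤ Kc →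
    0 ≤ c₀ → 0 ≤ θ → θ < 1 → c₀ + θ * δ ≤ δ → c₀ / (1 - θ) < δ₁ → 0 ≤ β →
    -- the multi-level class smallness of `ε`
    0 ≤ ε → ε ≤ 1 → cruxC (d + 1) L * ε < 1 → thetaLoc (d + 1) L * ε < 1 → (∀ k : ℕ, LevelSmall (d + 1) L k (ε / ((L : ℝ) ^ (k + 1)) ^ 2)) →
    -- the chart constants and F51's smallness of `C₀·(δ + 4(e^β − 1) + ε)`
    0 ≤ C₀ → 0 ≤ C₁ →
    4 * (3 + 12 * ((d + 1 : ℕ) : ℝ)) ^ 2 * (C₀ * (δ + 4 * (Real.exp β - 1) + ε)) ≤ rho0 (d + 1) L ^ 2 →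
    (8 * (3 + 12 * ((d + 1 : ℕ) : ℝ)) * (2 + 2 * ((((d + 1 : ℕ) : ℝ) + 1) * L)
        * (1 + ((1250 * ((nbRad (d + 1) L : ℝ) + L) + 8 * (((d + 1 : ℕ) : ℝ) * L) + 2 * L) * (((d + 1 : ℕ) : ℝ) * (2 * nbRad (d + 1) L + 1) ^ (d + 1)))
          / ((L : ℝ) / (L : ℝ) ^ (d + 1))))) * (C₀ * (δ + 4 * (Real.exp β - 1) + ε)) ≤ 1 →
    256 * (((d + 1 : ℕ) : ℝ) + 1) * L * (3 + 12 * ((d + 1 : ℕ) : ℝ)) * (C₀ * (δ + 4 * (Real.exp β - 1) + ε)) ≤ 1 →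
    -- THE BUDGET (F280): `C₀T ≤ 1` and the two closed-form inequalities
    C₀ * (δ + 4 * (Real.exp β - 1) + ε) ≤ 1 →
    ((K * (2 * (curl1C (d + 1) L / (1 - thetaLoc (d + 1) L * ε)) * (8 * (3 + 12 * ((d + 1 : ℕ) : ℝ)) * (2 + 2 * ((((d + 1 : ℕ) : ℝ) + 1) * L)
        * (1 + ((1250 * ((nbRad (d + 1) L : ℝ) + L) + 8 * (((d + 1 : ℕ) : ℝ) * L) + 2 * L) * (((d + 1 : ℕ) : ℝ) * (2 * nbRad (d + 1) L + 1) ^ (d + 1)))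
          / ((L : ℝ) / (L : ℝ) ^ (d + 1))))) * (C₀ * (δ + 4 * (Real.exp β - 1) + ε))) + K * Real.exp (-(c * ℓ)) * (2 * (curl1C (d + 1) L / (1 - thetaLoc (d + 1) L * ε)) * (8 * (3 + 12 * ((d + 1 : ℕ) : ℝ)) * (2 + 2 * ((((d + 1 : ℕ) : ℝ) + 1) * L)
        * (1 + ((1250 * ((nbRad (d + 1) L : ℝ) + L) + 8 * (((d + 1 : ℕ) : ℝ) * L) + 2 * L) * (((d + 1 : ℕ) : ℝ) * (2 * nbRad (d + 1) L + 1) ^ (d + 1)))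
          / ((L : ℝ) / (L : ℝ) ^ (d + 1))))) * (C₀ * (δ + 4 * (Real.exp β - 1) + ε)) + (curl1C (d + 1) L / (1 - thetaLoc (d + 1) L * ε))))
      + (K * ((Fintype.card (T4AveragingDeficitWall.Plane (d + 1)) : ℝ) * (((δ + 4 * (Real.exp β - 1) + ε) * (144 * C₀ * C₁ + 8 * C₁ ^ 2) + (δ + 4 * (Real.exp β - 1) + ε) ^ 2 * (5440 * C₀ ^ 3 + 304 * C₁ * C₀ ^ 2) + (δ + 4 * (Real.exp β - 1) + ε) ^ 3 * (2688 * C₀ ^ 4)) + 2 * ((δ + 4 * (Real.exp β - 1) + ε) * (144 * C₀ * (C₀ + C₁) + 8 * (C₀ + C₁) ^ 2) + (δ + 4 * (Real.exp β - 1) + ε) ^ 2 * (5440 * C₀ ^ 3 + 304 * (C₀ + C₁) * C₀ ^ 2) + (δ + 4 * (Real.exp β - 1) + ε) ^ 3 * (2688 * C₀ ^ 4))))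
      + K * Real.exp (-(c * ℓ)) * ((Fintype.card (T4AveragingDeficitWall.Plane (d + 1)) : ℝ) * (((δ + 4 * (Real.exp β - 1) + ε) * (144 * C₀ * C₁ + 8 * C₁ ^ 2) + (δ + 4 * (Real.exp β - 1) + ε) ^ 2 * (5440 * C₀ ^ 3 + 304 * C₁ * C₀ ^ 2) + (δ + 4 * (Real.exp β - 1) + ε) ^ 3 * (2688 * C₀ ^ 4)) + 2 * ((δ + 4 * (Real.exp β - 1) + ε) * (144 * C₀ * (C₀ + C₁) + 8 * (C₀ + C₁) ^ 2) + (δ + 4 * (Real.exp β - 1) + ε) ^ 2 * (5440 * C₀ ^ 3 + 304 * (C₀ + C₁) * C₀ ^ 2) + (δ + 4 * (Real.exp β - 1) + ε) ^ 3 * (2688 * C₀ ^ 4))) + 4 * (Fintype.card (T4AveragingDeficitWall.Plane (d + 1)) : ℝ) * (C₀ + C₁))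
      + (Fintype.card n : ℝ) * (2 * (CdecD d * (((d : ℝ) + 1) * (2 * ((d : ℝ) + 1))
              * ((2 + 32 / (kappa163 (d + 1) / (d + 1)) ^ 2) * latticeConst (d + 1) (kappa163 (d + 1) / (d + 1) / 2))))) * (1 + 12 * ((d : ℝ) + 1)) * ((28 * ((3 + 12 * ((d + 1 : ℕ) : ℝ)) + (4 * (3 + 12 * ((d + 1 : ℕ) : ℝ)) ^ 3 / rho0 (d + 1) L ^ 2) * (C₀ * (δ + 4 * (Real.exp β - 1) + ε))) ^ 2 + 4 * (4 * (3 + 12 * ((d + 1 : ℕ) : ℝ)) ^ 3 / rho0 (d + 1) L ^ 2)) * (C₀ ^ 2 * (δ + 4 * (Real.exp β - 1) + ε)))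
      + ((Fintype.card n : ℝ) * (2 * (CdecD d * (((d : ℝ) + 1) * (latticeConst (d + 1) (kappa163 (d + 1) / (d + 1) / 2) * Real.exp (-(kappa163 (d + 1) / (d + 1) / 2 * ℓ))))))) * ((3 + 12 * ((d + 1 : ℕ) : ℝ)) * C₀ + ((d : ℝ) + 1) * (4 * ((ℓ + 1 : ℕ) : ℝ) + 2) * (2 * (3 + 12 * ((d + 1 : ℕ) : ℝ)) * C₀ + ((28 * ((3 + 12 * ((d + 1 : ℕ) : ℝ)) + (4 * (3 + 12 * ((d + 1 : ℕ) : ℝ)) ^ 3 / rho0 (d + 1) L ^ 2) * (C₀ * (δ + 4 * (Real.exp β - 1) + ε))) ^ 2 + 4 * (4 * (3 + 12 * ((d + 1 : ℕ) : ℝ)) ^ 3 / rho0 (d + 1) L ^ 2)) * (C₀ ^ 2 * (δ + 4 * (Real.exp β - 1) + ε))))) + 28 * C₀ ^ 2 * (δ + 4 * (Real.exp β - 1) + ε)) ≤ θ) →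
    ((K * ((Fintype.card (T4AveragingDeficitWall.Plane (d + 1)) : ℝ) * (((δ + 4 * (Real.exp β - 1) + ε) * (144 * C₀ * C₁ + 8 * C₁ ^ 2) + (δ + 4 * (Real.exp β - 1) + ε) ^ 2 * (5440 * C₀ ^ 3 + 304 * C₁ * C₀ ^ 2) + (δ + 4 * (Real.exp β - 1) + ε) ^ 3 * (2688 * C₀ ^ 4)) + 2 * ((δ + 4 * (Real.exp β - 1) + ε) * (144 * C₀ * (C₀ + C₁) + 8 * (C₀ + C₁) ^ 2) + (δ + 4 * (Real.exp β - 1) + ε) ^ 2 * (5440 * C₀ ^ 3 + 304 * (C₀ + C₁) * C₀ ^ 2) + (δ + 4 * (Real.exp β - 1) + ε) ^ 3 * (2688 * C₀ ^ 4))))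
      + K * Real.exp (-(c * ℓ)) * ((Fintype.card (T4AveragingDeficitWall.Plane (d + 1)) : ℝ) * (((δ + 4 * (Real.exp β - 1) + ε) * (144 * C₀ * C₁ + 8 * C₁ ^ 2) + (δ + 4 * (Real.exp β - 1) + ε) ^ 2 * (5440 * C₀ ^ 3 + 304 * C₁ * C₀ ^ 2) + (δ + 4 * (Real.exp β - 1) + ε) ^ 3 * (2688 * C₀ ^ 4)) + 2 * ((δ + 4 * (Real.exp β - 1) + ε) * (144 * C₀ * (C₀ + C₁) + 8 * (C₀ + C₁) ^ 2) + (δ + 4 * (Real.exp β - 1) + ε) ^ 2 * (5440 * C₀ ^ 3 + 304 * (C₀ + C₁) * C₀ ^ 2) + (δ + 4 * (Real.exp β - 1) + ε) ^ 3 * (2688 * C₀ ^ 4))) + 4 * (Fintype.card (T4AveragingDeficitWall.Plane (d + 1)) : ℝ) * (C₀ + C₁))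
      + (Fintype.card n : ℝ) * (2 * (CdecD d * (((d : ℝ) + 1) * (2 * ((d : ℝ) + 1))
              * ((2 + 32 / (kappa163 (d + 1) / (d + 1)) ^ 2) * latticeConst (d + 1) (kappa163 (d + 1) / (d + 1) / 2))))) * (1 + 12 * ((d : ℝ) + 1)) * ((28 * ((3 + 12 * ((d + 1 : ℕ) : ℝ)) + (4 * (3 + 12 * ((d + 1 : ℕ) : ℝ)) ^ 3 / rho0 (d + 1) L ^ 2) * (C₀ * (δ + 4 * (Real.exp β - 1) + ε))) ^ 2 + 4 * (4 * (3 + 12 * ((d + 1 : ℕ) : ℝ)) ^ 3 / rho0 (d + 1) L ^ 2)) * (C₀ ^ 2 * (δ + 4 * (Real.exp β - 1) + ε)))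
      + ((Fintype.card n : ℝ) * (2 * (CdecD d * (((d : ℝ) + 1) * (latticeConst (d + 1) (kappa163 (d + 1) / (d + 1) / 2) * Real.exp (-(kappa163 (d + 1) / (d + 1) / 2 * ℓ))))))) * ((3 + 12 * ((d + 1 : ℕ) : ℝ)) * C₀ + ((d : ℝ) + 1) * (4 * ((ℓ + 1 : ℕ) : ℝ) + 2) * (2 * (3 + 12 * ((d + 1 : ℕ) : ℝ)) * C₀ + ((28 * ((3 + 12 * ((d + 1 : ℕ) : ℝ)) + (4 * (3 + 12 * ((d + 1 : ℕ) : ℝ)) ^ 3 / rho0 (d + 1) L ^ 2) * (C₀ * (δ + 4 * (Real.exp β - 1) + ε))) ^ 2 + 4 * (4 * (3 + 12 * ((d + 1 : ℕ) : ℝ)) ^ 3 / rho0 (d + 1) L ^ 2)) * (C₀ ^ 2 * (δ + 4 * (Real.exp β - 1) + ε))))) + 28 * C₀ ^ 2 * (δ + 4 * (Real.exp β - 1) + ε)) * (4 * (Real.exp β - 1) + ε)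
      + ((Fintype.card n : ℝ) * (2 * (CdecD d * (((d : ℝ) + 1) * (2 * ((d : ℝ) + 1))
              * ((2 + 32 / (kappa163 (d + 1) / (d + 1)) ^ 2) * latticeConst (d + 1) (kappa163 (d + 1) / (d + 1) / 2))))) * (1 + 12 * ((d : ℝ) + 1)) + ((Fintype.card n : ℝ) * (2 * (CdecD d * (((d : ℝ) + 1) * (latticeConst (d + 1) (kappa163 (d + 1) / (d + 1) / 2) * Real.exp (-(kappa163 (d + 1) / (d + 1) / 2 * ℓ))))))) * (((d : ℝ) + 1) * (4 * ((ℓ + 1 : ℕ) : ℝ) + 2))) * (4 * (Real.exp β - 1)) ≤ c₀) →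
    -- THE CHART (N1)-weak: [B8] Thm 2 at `U₀ = 1` on nested cubes, TYPE (asserted for nothing here)
    (∀ D : Site (d + 1) → Fin (d + 1) → (Matrix n n ℂ)ˣ, IsUnitaryCfg D → IsPeriodicCfg D ((N * Kc) : ℤ) → SmallField D (4 * (Real.exp β - 1)) →
      ∀ (k : ℕ), ∀ U ∈ admissible (sfClass (d + 1) L (N * Kc) ε) L (k + 1) D,
      (∀ φ : Site (d + 1) → Fin (d + 1) → Matrix n n ℂ, IsSkewDir φ → IsPeriodicDir φ (((N * Kc) * L ^ (k + 1) : ℕ) : ℤ) → TangentIter L k U φ →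
        dAction U φ (perWin (d + 1) ((N * Kc) * L ^ (k + 1))) = 0) →
      ∀ r : ℝ, 0 ≤ r → r ≤ δ → SmallField U (r / ((L : ℝ) ^ (k + 1)) ^ 2) →
      ∀ z : Site (d + 1), ∃ (u : Site (d + 1) → (Matrix n n ℂ)ˣ) (At : Site (d + 1) → Fin (d + 1) → Matrix n n ℂ) (a₀ a₁ : ℝ),
        IsUnitarySite u ∧ (∀ (y : Site (d + 1)) (i : Fin (d + 1)), u (y + (((N * Kc) * L ^ (k + 1) : ℕ) : ℤ) • e i) = u y) ∧
        IsSkewDir At ∧ IsPeriodicDir At (((N * Kc) * L ^ (k + 1) : ℕ) : ℤ) ∧ 0 ≤ a₀ ∧ 0 ≤ a₁ ∧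
        (∀ (y : Site (d + 1)) (κ : Fin (d + 1)), ‖At y κ‖ ≤ a₀) ∧ (∀ (y : Site (d + 1)) (κ τ : Fin (d + 1)), ‖At (y + e τ) κ - At y κ‖ ≤ a₁) ∧
        (L : ℝ) ^ (k + 1) * a₀ ≤ C₀ * (r + 4 * (Real.exp β - 1) + ε) ∧ ((L : ℝ) ^ (k + 1)) ^ 2 * a₁ ≤ C₁ * (r + 4 * (Real.exp β - 1) + ε) ∧
        (∀ (y : Site (d + 1)) (κ : Fin (d + 1)),
          torusSupNorm (fun _ : Fin (d + 1) => L ^ (k + 1) * (N * Kc)) (y - z) ≤ (((nbRad (d + 1) L + 2 * ℓ + 10) * L ^ (k + 1) : ℕ) : ℝ) →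
            gaugeAct u U y κ = vary (flat (d := d + 1) (n := n)) At 1 y κ)) →
    ∀ D : Site (d + 1) → Fin (d + 1) → (Matrix n n ℂ)ˣ, IsUnitaryCfg D → IsPeriodicCfg D (N : ℤ) → SmallField D (4 * (Real.exp β - 1)) →
      ∀ (k : ℕ), ∀ U ∈ admissible (sfClass (d + 1) L N ε) L (k + 1) D, SmallField U (δ / ((L : ℝ) ^ (k + 1)) ^ 2) →
      (∀ φ : Site (d + 1) → Fin (d + 1) → Matrix n n ℂ, IsSkewDir φ → IsPeriodicDir φ ((N * L ^ (k + 1) : ℕ) : ℤ) → TangentIter L k U φ →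
        dAction U φ (perWin (d + 1) (N * L ^ (k + 1))) = 0) → SmallField U (δ₁ / ((L : ℝ) ^ (k + 1)) ^ 2)
  := by
  classical
  have hL1 : 1 ≤ L := by omega
  obtain ⟨K, c, hK, hc, hF⟩ := hape_of_localChart_budget (n := n) (d := d) (L := L) hL
  refine ⟨K, c, hK, hc, ?_⟩
  intro N ℓ Kc _ ε δ δ₁ β c₀ θ C₀ C₁ hℓ hKc hc₀ hθ0 hθ1 hcδ hδ₁ hβ hε hε1 hθ hθl hLS hC₀ hC₁ hσ' hS1' hb' hC₀T hbθ hbc₀ hchart D hDu hDP hDs k U hU hUδ hcrit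
  -- the cover
  have hm : 1 ≤ Kc := by omega
  have hN1 : 1 ≤ N := Nat.one_le_iff_ne_zero.mpr (NeZero.ne N)
  haveI : NeZero (N * Kc) := ⟨Nat.mul_ne_zero (NeZero.ne N) (by omega)⟩
  have hN' : 4 * ℓ + 12 ≤ N * Kc := le_trans hKc (Nat.le_mul_of_pos_left _ (Nat.pos_of_ne_zero (NeZero.ne N)))
  -- the datum and the configuration on the cover
  have hDP' : IsPeriodicCfg D ((N * Kc : ℕ) : ℤ) := by
    rw [show ((N * Kc : ℕ) : ℤ) = (N : ℤ) * ((Kc : ℕ) : ℤ) by push_cast; ring]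
    exact isPeriodicCfg_mul hDP _
  have hUcl : U ∈ sfClass (d + 1) L N ε (k + 1) := hU.1
  have hUP : IsPeriodicCfg U ((N * L ^ (k + 1) : ℕ) : ℤ) := hUcl.2.1
  have hUP' : IsPeriodicCfg U ((N * Kc * L ^ (k + 1) : ℕ) : ℤ) := by
    rw [show ((N * Kc * L ^ (k + 1) : ℕ) : ℤ) = ((N * L ^ (k + 1) : ℕ) : ℤ) * ((Kc : ℕ) : ℤ) by push_cast; ring]
    exact isPeriodicCfg_mul hUP _
  have hU' : U ∈ admissible (sfClass (d + 1) L (N * Kc) ε) L (k + 1) D := ⟨⟨hUcl.1, hUP', hUcl.2.2⟩, hU.2⟩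
  -- tangent-criticality on the cover (p2's `tanCritical_cover`)
  have hmc : N * L ^ (k + 1) = L ^ (k + 1) * N := Nat.mul_comm _ _
  have hUPc : IsPeriodicCfg U ((L ^ (k + 1) * N : ℕ) : ℤ) := by rw [← hmc]; exact hUP
  have hcritD : ∀ φ : Site (d + 1) → Fin (d + 1) → Matrix n n ℂ, IsSkewDir φ → IsPeriodicDir φ ((L ^ (k + 1) * N : ℕ) : ℤ) →
      dirIter L (k + 1) U φ = 0 → dAction U φ (perWin (d + 1) (L ^ (k + 1) * N)) = 0 := by
    intro φ hφ hφP hφT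
    rw [← hmc] at hφP ⊢
    exact hcrit φ hφ hφP ((tangentIter_iff_dirIter_eq_zero L k U φ).mpr hφT)
  have hx0 : 0 ≤ ε / ((L : ℝ) ^ (k + 1)) ^ 2 := by positivity
  have hcov := tanCritical_cover hL1 k hN1 hm hUcl.1 hx0 (hLS k) hUcl.2.2 hUPc hcritD
  have hmc' : N * Kc * L ^ (k + 1) = L ^ (k + 1) * (N * Kc) := by ring
  have hcrit' : ∀ φ : Site (d + 1) → Fin (d + 1) → Matrix n n ℂ, IsSkewDir φ → IsPeriodicDir φ ((N * Kc * L ^ (k + 1) : ℕ) : ℤ) →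
      TangentIter L k U φ → dAction U φ (perWin (d + 1) (N * Kc * L ^ (k + 1))) = 0 := by
    intro φ hφ hφP hφT
    rw [hmc'] at hφP ⊢
    exact hcov φ hφ hφP ((tangentIter_iff_dirIter_eq_zero L k U φ).mp hφT)
  exact hF (N * Kc) ℓ ε δ δ₁ β c₀ θ C₀ C₁ hℓ hN' hc₀ hθ0 hθ1 hcδ hδ₁ hβ hε hε1 hθ hθl hLS hC₀ hC₁ hσ' hS1' hb' hC₀T hbθ hbc₀ hchart
    D hDu hDP' hDs k U hU' hUδ hcrit'

end

end Summit.QuantumFields.BalabanUV.T4Continuum.NE7HapeOfLocalChartWide
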